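import Summits.MatrixMultiplication.MatrixMultiplication.Theses.NilpotentLieHosts

/-!
# Route NilpotentLieHosts — `HeisenbergBranch` (item stmt-MatrixMultiplication-7727, support)

The Heisenberg branch closes the summit by itself:
`HeisenbergEnvelopingCost → HeisenbergThresholdDesigns → MatrixMultiplication` (`ω(ℂ) = 2`).

Pure exponent bookkeeping over `ℝ` (the `d = 3`, `b = 1` instance of the route's deciding theorem
`closes`): `2 ≤ ω` is the tree's flattening bound `omega_two_le`; if `2 < ω`, feed the design
half the loss `δ := (ω-2)/(2ω) > 0`.  The design exponent `(9/2 - δ)·(ω/3)` then exceeds the cost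
exponent `F := ω + 1` by exactly `g := (ω-2)/3 > 0`, so a design at budget `s ≥ 1` gives
`s^g · s^F ≤ (|X||Y||Z|)^(ω/3) ≤ C·(s+1)^F ≤ max C 1 · max 1 2^F · s^F`, i.e.
`s^g ≤ max C 1 · max 1 2^F`, impossible for the unboundedly large budgets the design half supplies
(`tendsto_rpow_atTop`).  No upper bound on `ω` is used.

Sources: Blaser2013 (Def. 5.1, `ω ≥ 2`), BlasiakCohnGrochowPrattUmans2024 (Thm 2.2 / Rem 2.4, the
shape of the cost inequality).
-/

-- the tree's namespace `Summit.MatrixMultiplication.MatrixMultiplication.…` repeats a component by design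
set_option linter.dupNamespace false

namespace Summit.MatrixMultiplication.MatrixMultiplication.Theorems

open Summit.MatrixMultiplication.MatrixMultiplication.Theses.NilpotentLieHosts

/-- **HeisenbergBranch** (item stmt-MatrixMultiplication-7727): the Heisenberg cost bound
`(|X||Y||Z|)^(ω/3) ≤ C (s+1)^(ω+1)` together with threshold designs `|X||Y||Z| ≥ s^(9/2-δ)` at
unboundedly many budgets `s`, for every `δ > 0`, force `ω(ℂ) = 2`: for `ω > 2` the choice
`δ := (ω-2)/(2ω)` leaves a gap `s^((ω-2)/3) ≤ max C 1 · max 1 2^(ω+1)`, absurd as `s → ∞`;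
`ω ≥ 2` is `omega_two_le`. -/
theorem heisenbergBranch_proof : HeisenbergBranch := by
  unfold HeisenbergBranch
  intro hCost hDesign
  show Literature.Computability.AlgebraicComplexity.omega ℂ = 2
  have hw2 : 2 ≤ Literature.Computability.AlgebraicComplexity.omega ℂ :=
    Literature.Computability.AlgebraicComplexity.omega_two_le ℂ
  refine le_antisymm ?_ hw2
  refine not_lt.1 fun hlt => ?_
  set w : ℝ := Literature.Computability.AlgebraicComplexity.omega ℂ with hwdef
  -- the cost constant `C`
  obtain ⟨C, hC⟩ := hCost
  have hwpos : 0 < w := lt_of_lt_of_le two_pos hw2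
  have hw2' : 0 < w - 2 := sub_pos.2 hlt
  -- the loss `δ = (w-2)/(2w)` fed to the design half, the cost exponent `F`, the gap `g`
  have hδ : 0 < (w - 2) / (2 * w) := div_pos hw2' (mul_pos two_pos hwpos)
  set F : ℝ := w + 1 with hFdef
  set g : ℝ := (w - 2) / 3 with hgdef
  have hg : 0 < g := div_pos hw2' three_pos
  have hcancel : (w - 2) / (2 * w) * (w / 3) = (w - 2) / 6 := by
    field_simp
    ring
  have hexp : ((9 : ℝ) / 2 - (w - 2) / (2 * w)) * (w / 3) = g + F := by
    rw [sub_mul, hcancel, hgdef, hFdef]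
    ring
  -- constants: `C' = max C 1` and `K = max 1 2^F` with `(s+1)^F ≤ K·s^F` for `s ≥ 1`
  set C' : ℝ := max C 1 with hC'def
  set K : ℝ := max 1 ((2 : ℝ) ^ F) with hKdef
  have hC'1 : 1 ≤ C' := le_max_right _ _
  have hK1 : 1 ≤ K := le_max_left _ _
  have hC'0 : 0 ≤ C' := zero_le_one.trans hC'1
  -- `x ↦ x^g` is unbounded: beyond `M` it exceeds `C'·K + 1`
  obtain ⟨M, hM⟩ := Filter.tendsto_atTop_atTop.1 (tendsto_rpow_atTop hg) (C' * K + 1)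
  -- a design at a budget `s ≥ max 1 ⌈M⌉₊`, and its price
  obtain ⟨s, hs, X, Y, Z, hU, hT, hS, hV⟩ := hDesign ((w - 2) / (2 * w)) hδ (max 1 (Nat.ceil M))
  have hs1 : 1 ≤ s := (le_max_left _ _).trans hs
  have hsM : M ≤ (s : ℝ) :=
    (Nat.le_ceil M).trans (by exact_mod_cast (le_max_right 1 (Nat.ceil M)).trans hs)
  have hsR1 : (1 : ℝ) ≤ s := by exact_mod_cast hs1
  have hsR0 : (0 : ℝ) < s := one_pos.trans_le hsR1
  have hcost := hC s X Y Z hU hT hS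
  -- real bookkeeping
  have hsF : (0 : ℝ) < (s : ℝ) ^ F := Real.rpow_pos_of_pos hsR0 F
  have h1 : (s : ℝ) ^ g * (s : ℝ) ^ F ≤ ((X.card : ℝ) * Y.card * Z.card) ^ (w / 3) := by
    rw [← Real.rpow_add hsR0, ← hexp, Real.rpow_mul hsR0.le]
    exact Real.rpow_le_rpow (Real.rpow_nonneg hsR0.le _) hV (div_nonneg hwpos.le three_pos.le)
  have hF0 : 0 ≤ F := by
    rw [hFdef]
    linarith
  have h2 : C * ((s : ℝ) + 1) ^ F ≤ C' * (K * (s : ℝ) ^ F) := by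
    have hs1F : (0 : ℝ) ≤ ((s : ℝ) + 1) ^ F := Real.rpow_nonneg (by positivity) F
    have h3 : ((s : ℝ) + 1) ^ F ≤ K * (s : ℝ) ^ F := by
      calc ((s : ℝ) + 1) ^ F ≤ (2 * (s : ℝ)) ^ F :=
            Real.rpow_le_rpow (by positivity) (by linarith) hF0
        _ = (2 : ℝ) ^ F * (s : ℝ) ^ F := Real.mul_rpow zero_le_two hsR0.le
        _ ≤ K * (s : ℝ) ^ F := mul_le_mul_of_nonneg_right (le_max_right _ _) hsF.le
    calc C * ((s : ℝ) + 1) ^ F ≤ C' * ((s : ℝ) + 1) ^ F :=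
          mul_le_mul_of_nonneg_right (le_max_left _ _) hs1F
      _ ≤ C' * (K * (s : ℝ) ^ F) := mul_le_mul_of_nonneg_left h3 hC'0
  have h4 : (s : ℝ) ^ g * (s : ℝ) ^ F ≤ C' * K * (s : ℝ) ^ F := by
    rw [mul_assoc]
    exact h1.trans (hcost.trans h2)
  have h5 : (s : ℝ) ^ g ≤ C' * K := le_of_mul_le_mul_right h4 hsF
  have h6 : C' * K + 1 ≤ (s : ℝ) ^ g := hM (s : ℝ) hsM
  linarith

end Summit.MatrixMultiplication.MatrixMultiplication.Theorems
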